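import Literature.NumberTheory.Automorphic.UnipotentDiagConjModulus
import Literature.NumberTheory.Automorphic.RankinSelbergTorusIntegral
import Literature.NumberTheory.Automorphic.IdeleModuleProofs
import HarnessLib

/-!
# The torus weight of the unfolded Rankin–Selberg integral is `|det a|^σ δ_B(a)⁻¹`

Topic `NumberTheory/Automorphic`; namespace `Literature.NumberTheory.Automorphic`. The bookkeeping
identity behind the Iwasawa form of the unfolded Rankin–Selberg integral (Cogdell (2004), §2.3,
`dg = du δ_B(a)⁻¹ da dk`): for `a ∈ (𝔸_Kˣ)ⁿ`,

* `colRangeDiagModulus_zero_eq_prod` — the modulus of `u ↦ a u a⁻¹` on `N_n(𝔸_K) = U_{[0,n-1]}(𝔸_K)`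
  is `δ_B(a) = ∏_{c} ∏_{i<c} ‖aᵢ/a_c‖` (`UnipotentDiagConjModulus`, the range `[0, b]`);
* `prod_prod_div_eq_prod_rpow` — the elementary identity
  `∏_c ∏_{i<c} (x_c / xᵢ) = ∏_j x_j^{2j-(n-1)}` for positive reals;
* `ofReal_torusWeight_eq` — **`torusWeight σ a = |det diag(a)|_𝔸^σ · δ_B(a)⁻¹`** in `[0, ∞]`
  (`torusWeight σ a = ∏_j ‖a_j‖^{σ-(n-1-2j)}` of `RankinSelbergTorusIntegral`; `distribHaarChar = ‖·‖_𝔸`,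
  `AdeleRing.distribHaarChar_eq_ideleNorm`).

Everything is proved.
-/

noncomputable section

open MeasureTheory Measure NumberField IsDedekindDomain Matrix Set Filter Finset
open scoped MatrixGroups ENNReal NNReal
open Literature.NumberTheory.GaloisRepresentations (ideleGroup)

namespace Literature.NumberTheory.Automorphic

section Modulus

variable {n : ℕ} {K : Type} [Field K] [NumberField K]
variable [MeasurableSpace (GL (Fin n) (AdeleRing (𝓞 K) K))] [BorelSpace (GL (Fin n) (AdeleRing (𝓞 K) K))]

/-- `δ_{[0,0]}(d) = 1`: the range `[0,0]` is the (empty) part of column `0` above the diagonal.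
[folklore] -/
theorem colRangeDiagModulus_zero_zero [LocallyCompactSpace (AdeleRing (𝓞 K) K)] (hn : 0 < n)
    (d : Fin n → (AdeleRing (𝓞 K) K)ˣ) :
    (colRangeDiagModulus (n := n) (K := K) 0 0 d : ℝ≥0∞) = 1 := by
  rw [colRangeDiagModulus_col hn d]
  haveI : IsEmpty (ColIdx n 0) := ⟨fun j => Nat.not_lt_zero _ j.2⟩
  exact Fintype.prod_empty _

/-- **`δ_{[0,b]}(d) = ∏_{1 ≤ c ≤ b} ∏_{i<c} ‖dᵢ/d_c‖`** (`b < n`): the modulus of diagonal conjugation on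
`U_{[0,b]}(𝔸_K)`; for `b = n - 1` this is `N_n(𝔸_K)` and `δ_B`. [folklore] -/
theorem colRangeDiagModulus_zero_eq_prod [LocallyCompactSpace (AdeleRing (𝓞 K) K)] (hn : 0 < n)
    (d : Fin n → (AdeleRing (𝓞 K) K)ˣ) {b : ℕ} (hb : b < n) :
    (colRangeDiagModulus (n := n) (K := K) 0 b d : ℝ≥0∞) = ∏ c ∈ Finset.Icc 1 b, colDiagFactor (K := K) d c := by
  rw [colRangeDiagModulus_split (a := 0) (b := b) 0 (by omega) (Nat.zero_le b) d, ENNReal.coe_mul,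
    colRangeDiagModulus_one_eq_prod d b hb, colRangeDiagModulus_zero_zero hn d, mul_one]

end Modulus

/-! ### The elementary identity -/

section Elementary

/-- `∏_c ∏_{i<c} x_i = ∏_i x_i^{n-1-i}` (each `x_i` appears once for every `c > i`). [folklore] -/
theorem prod_prod_filter_lt_eq_prod_pow {n : ℕ} (x : Fin n → ℝ) :
    ∏ c : Fin n, ∏ i ∈ univ.filter (fun i : Fin n => i < c), x i = ∏ i : Fin n, x i ^ ((n : ℕ) - 1 - (i : ℕ)) := by
  have h1 : ∀ c : Fin n, ∏ i ∈ univ.filter (fun i : Fin n => i < c), x i = ∏ i : Fin n, (if i < c then x i else 1) :=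
    fun c => (prod_filter _ _)
  simp_rw [h1]
  rw [Finset.prod_comm]
  refine prod_congr rfl fun i _ => ?_
  rw [prod_ite, prod_const_one, mul_one, prod_const]
  congr 1
  rw [show (univ.filter fun c : Fin n => i < c) = Finset.Ioi i from by
    ext c; simp only [Finset.mem_filter, Finset.mem_univ, true_and, Finset.mem_Ioi], Fin.card_Ioi]

/-- `∏_c ∏_{i<c} x_c = ∏_c x_c^{c}`. [folklore] -/
theorem prod_prod_filter_lt_const_eq_prod_pow {n : ℕ} (x : Fin n → ℝ) :
    ∏ c : Fin n, ∏ _i ∈ univ.filter (fun i : Fin n => i < c), x c = ∏ c : Fin n, x c ^ (c : ℕ) := by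
  refine prod_congr rfl fun c _ => ?_
  rw [prod_const]
  congr 1
  rw [show (univ.filter fun i : Fin n => i < c) = Finset.Iio c from by
    ext i; simp only [Finset.mem_filter, Finset.mem_univ, true_and, Finset.mem_Iio], Fin.card_Iio]

/-- **`∏_c ∏_{i<c} (x_c / x_i) = ∏_j x_j^{2j-(n-1)}`** for positive reals `x_j`. [folklore] -/
theorem prod_prod_div_eq_prod_rpow {n : ℕ} (x : Fin n → ℝ) (hx : ∀ i, 0 < x i) :
    ∏ c : Fin n, ∏ i ∈ univ.filter (fun i : Fin n => i < c), (x c / x i) =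
      ∏ j : Fin n, x j ^ (2 * (j : ℕ) - ((n : ℝ) - 1)) := by
  have hdiv : ∀ c : Fin n, ∏ i ∈ univ.filter (fun i : Fin n => i < c), (x c / x i) =
      (∏ i ∈ univ.filter (fun i : Fin n => i < c), x c) / ∏ i ∈ univ.filter (fun i : Fin n => i < c), x i :=
    fun c => prod_div_distrib _ _
  simp_rw [hdiv]
  rw [prod_div_distrib, prod_prod_filter_lt_const_eq_prod_pow, prod_prod_filter_lt_eq_prod_pow, ← prod_div_distrib]
  refine prod_congr rfl fun j _ => ?_
  have hj : (j : ℕ) ≤ n - 1 := by have := j.2; omega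
  rw [← Real.rpow_natCast, ← Real.rpow_natCast, ← Real.rpow_sub (hx j)]
  congr 1
  rw [Nat.cast_sub hj, Nat.cast_sub (by have := j.2; omega : 1 ≤ n)]
  push_cast
  ring

/-- **`∏_j x_j^{σ-(n-1-2j)} = (∏_j x_j)^σ · (∏_c ∏_{i<c} (x_i / x_c))⁻¹`** for positive reals. [folklore] -/
theorem prod_rpow_sub_eq {n : ℕ} (x : Fin n → ℝ) (hx : ∀ i, 0 < x i) (σ : ℝ) :
    ∏ j : Fin n, x j ^ (σ - ((n : ℝ) - 1 - 2 * (j : ℕ))) =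
      (∏ j : Fin n, x j) ^ σ * (∏ c : Fin n, ∏ i ∈ univ.filter (fun i : Fin n => i < c), (x i / x c))⁻¹ := by
  have hinv : (∏ c : Fin n, ∏ i ∈ univ.filter (fun i : Fin n => i < c), (x i / x c))⁻¹ =
      ∏ c : Fin n, ∏ i ∈ univ.filter (fun i : Fin n => i < c), (x c / x i) := by
    rw [← prod_inv_distrib]
    refine prod_congr rfl fun c _ => ?_
    rw [← prod_inv_distrib]
    refine prod_congr rfl fun i _ => ?_
    rw [inv_div]
  rw [hinv, prod_prod_div_eq_prod_rpow x hx, ← Real.finsetProd_rpow _ _ (fun j _ => (hx j).le), ← prod_mul_distrib]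
  refine prod_congr rfl fun j _ => ?_
  rw [← Real.rpow_add (hx j)]
  congr 1
  ring

end Elementary

/-! ### The torus weight -/

section TorusWeight

variable {n : ℕ} {K : Type} [Field K] [NumberField K]

/-- `det (diag a) = ∏ aᵢ` (units). [folklore] -/
theorem det_glDiagonal' (a : Fin n → (AdeleRing (𝓞 K) K)ˣ) :
    Matrix.GeneralLinearGroup.det (glDiagonal n (AdeleRing (𝓞 K) K) a) = ∏ k, a k := by
  refine Units.ext ?_
  change (glDiagonal n (AdeleRing (𝓞 K) K) a : Matrix (Fin n) (Fin n) (AdeleRing (𝓞 K) K)).det = _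
  rw [coe_glDiagonal, Matrix.det_diagonal, Units.coe_prod]

/-- The double product `∏_{1 ≤ c ≤ n-1} colDiagFactor a c` as a product over `Fin n × (i < c)` of idelic
norms (real numbers). [folklore] -/
theorem prod_colDiagFactor_eq [LocallyCompactSpace (AdeleRing (𝓞 K) K)] (hn : 0 < n)
    (a : Fin n → (AdeleRing (𝓞 K) K)ˣ) :
    ∏ c ∈ Finset.Icc 1 (n - 1), colDiagFactor (K := K) a c =
      ENNReal.ofReal (∏ c : Fin n, ∏ i ∈ univ.filter (fun i : Fin n => i < c),
        ((IdeleClassGroup.ideleNorm K (a i) : ℝ) / (IdeleClassGroup.ideleNorm K (a c) : ℝ))) := by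
  have hpos : ∀ i : Fin n, (0 : ℝ) < IdeleClassGroup.ideleNorm K (a i) := fun i =>
    NNReal.coe_pos.2 (pos_iff_ne_zero.2 (ideleNorm_ne_zero _))
  set x : Fin n → ℝ := fun i => (IdeleClassGroup.ideleNorm K (a i) : ℝ) with hx
  -- each factor `‖a_i a_c⁻¹‖_𝔸` as `ofReal (x_i / x_c)`
  have hfac : ∀ i c : Fin n, (distribHaarChar (AdeleRing (𝓞 K) K) (a i * (a c)⁻¹) : ℝ≥0∞) = ENNReal.ofReal (x i / x c) := by
    intro i c
    rw [map_mul, map_inv, AdeleRing.distribHaarChar_eq_ideleNorm, AdeleRing.distribHaarChar_eq_ideleNorm,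
      ENNReal.ofReal_div_of_pos (hpos c), ENNReal.ofReal_coe_nnreal, ENNReal.ofReal_coe_nnreal, ENNReal.coe_mul,
      ENNReal.coe_inv (ideleNorm_ne_zero _), div_eq_mul_inv]
  -- each column factor as `ofReal` of a real product
  have hcol : ∀ c : Fin n, colDiagFactor (K := K) a c =
      ENNReal.ofReal (∏ i ∈ univ.filter (fun i : Fin n => i < c), (x i / x c)) := by
    intro c
    unfold colDiagFactor
    rw [dif_pos c.2, ENNReal.ofReal_prod_of_nonneg (fun i _ => (div_pos (hpos i) (hpos c)).le)]
    have hc : (⟨(c : ℕ), c.2⟩ : Fin n) = c := Fin.ext rfl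
    have e1 : ∏ i : ColIdx n c, (distribHaarChar (AdeleRing (𝓞 K) K) (a i.1 * (a ⟨(c : ℕ), c.2⟩)⁻¹) : ℝ≥0∞) =
        ∏ i : ColIdx n c, ENNReal.ofReal (x i.1 / x c) :=
      Fintype.prod_congr _ _ fun i => by rw [hc, hfac]
    rw [e1]
    exact (Finset.prod_subtype (univ.filter fun i : Fin n => i < c)
      (fun i => by simp only [Finset.mem_filter, Finset.mem_univ, true_and]; exact Fin.lt_def)
      (fun i : Fin n => ENNReal.ofReal (x i / x c))).symm
  have hpos' : ∀ c : Fin n, (0 : ℝ) ≤ ∏ i ∈ univ.filter (fun i : Fin n => i < c), (x i / x c) :=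
    fun c => prod_nonneg fun i _ => (div_pos (hpos i) (hpos c)).le
  rw [ENNReal.ofReal_prod_of_nonneg (fun c _ => hpos' c),
    show (∏ c : Fin n, ENNReal.ofReal (∏ i ∈ univ.filter (fun i : Fin n => i < c), (x i / x c))) =
      ∏ c : Fin n, colDiagFactor (K := K) a c from Fintype.prod_congr _ _ fun c => (hcol c).symm,
    Fin.prod_univ_eq_prod_range (fun c => colDiagFactor (K := K) a c) n]
  -- reindex `range n = {0} ∪ Icc 1 (n-1)`, the factor at `c = 0` being `1`
  have hrange : Finset.range n = insert 0 (Finset.Icc 1 (n - 1)) := by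
    ext c; simp only [Finset.mem_range, Finset.mem_insert, Finset.mem_Icc]; omega
  have h0 : colDiagFactor (K := K) a 0 = 1 := by
    unfold colDiagFactor
    rw [dif_pos hn]
    haveI : IsEmpty (ColIdx n 0) := ⟨fun j => Nat.not_lt_zero _ j.2⟩
    exact Fintype.prod_empty _
  rw [hrange, prod_insert (by simp), h0, one_mul]

variable [MeasurableSpace (GL (Fin n) (AdeleRing (𝓞 K) K))] [BorelSpace (GL (Fin n) (AdeleRing (𝓞 K) K))]

/-- **`torusWeight σ a = |det diag(a)|_𝔸^σ · δ_B(a)⁻¹`** in `[0, ∞]`, `δ_B(a) = colRangeDiagModulus 0 (n-1) a`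
the modulus of `u ↦ a u a⁻¹` on `N_n(𝔸_K)` (`0 < n`). [folklore] -/
theorem ofReal_torusWeight_eq [LocallyCompactSpace (AdeleRing (𝓞 K) K)] (hn : 0 < n) (σ : ℝ)
    (a : Fin n → ideleGroup K) :
    ENNReal.ofReal (torusWeight n K σ a) =
      ENNReal.ofReal ((IdeleClassGroup.ideleNorm K
        (Matrix.GeneralLinearGroup.det (glDiagonal n (AdeleRing (𝓞 K) K) a)) : ℝ) ^ σ) *
        ((colRangeDiagModulus (n := n) (K := K) 0 (n - 1) a : ℝ≥0∞))⁻¹ := by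
  have hpos : ∀ i : Fin n, (0 : ℝ) < IdeleClassGroup.ideleNorm K (a i) := fun i =>
    NNReal.coe_pos.2 (pos_iff_ne_zero.2 (ideleNorm_ne_zero _))
  set x : Fin n → ℝ := fun i => (IdeleClassGroup.ideleNorm K (a i) : ℝ) with hx
  have hdet : (IdeleClassGroup.ideleNorm K (Matrix.GeneralLinearGroup.det (glDiagonal n (AdeleRing (𝓞 K) K) a)) : ℝ) =
      ∏ j, x j := by
    rw [det_glDiagonal', map_prod, NNReal.coe_prod]
  have hδ : ((colRangeDiagModulus (n := n) (K := K) 0 (n - 1) a : ℝ≥0∞)) =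
      ENNReal.ofReal (∏ c : Fin n, ∏ i ∈ univ.filter (fun i : Fin n => i < c), (x i / x c)) := by
    rw [colRangeDiagModulus_zero_eq_prod hn a (b := n - 1) (by omega), prod_colDiagFactor_eq hn a]
  have hP : 0 < ∏ c : Fin n, ∏ i ∈ univ.filter (fun i : Fin n => i < c), (x i / x c) :=
    prod_pos fun c _ => prod_pos fun i _ => div_pos (hpos i) (hpos c)
  rw [torusWeight, hdet, hδ, ← ENNReal.ofReal_inv_of_pos hP,
    ← ENNReal.ofReal_mul (Real.rpow_nonneg (prod_nonneg fun j _ => (hpos j).le) σ)]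
  congr 1
  exact prod_rpow_sub_eq x hpos σ

end TorusWeight

end Literature.NumberTheory.Automorphic
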